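import HarnessLib
import Summits.RiemannHypothesis.RiemannHypothesis.Theorems.SignConePointwiseIdentity
import Summits.RiemannHypothesis.RiemannHypothesis.Theorems.SignConePointwiseSOSTailBound

/-!
# Route SignCone: positivity transfer with an out-of-window correction

Support for the unconditional rungs of `SignConeOscillatory` / `SignConeInequality`
(items stmt-RiemannHypothesis-16302 / 16301). Companion of `neg_slack_le_of_density_nonneg`
(`SignConePointwiseIdentity.lean`): the slack functional of a Weil test `g` supported in `[-b, b]` is
`(1/2π) ∫ |ĝ|² F` with the density `F` of the certificate, and any correction `H` whose frequencies
lie outside the window pairs to ZERO with `|ĝ|²` — for `x = log p − log q` with `|x| > 2b`,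
`(1/2π) ∫ |ĝ(1/2+iy)|² c cos(yx) dy = Re (c/2)(G(x) + G(−x)) = 0` because `G = g ⋆ g̃` is supported in
`[-2b, 2b]`. Hence `F + H ≥ 0` pointwise already gives the slack inequality:

* `integral_norm_sq_mul_Hsos_eq_zero` and **`neg_slack_le_of_density_add_Hsos_nonneg`**.
-/

noncomputable section

-- `Summit.RiemannHypothesis.RiemannHypothesis.…` repeats a namespace component by design (D-0017 layout).
set_option linter.dupNamespace false

open scoped BigOperators ComplexConjugate Real Topology
open Complex MeasureTheory Set Filter

namespace Summit.RiemannHypothesis.RiemannHypothesis.Theorems.SignCone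

open Literature.NumberTheory.LFunctions
open Summit.RiemannHypothesis.RiemannHypothesis.Theorems.SignConeOscillatory

section SpectralH

variable {g : ℝ → ℂ} (hg : IsWeilTest g) {b : ℝ} (hsupp : tsupport g ⊆ Icc (-b) b)
  {E : ℝ → ℝ} (hEc : Continuous E) (hEs : HasCompactSupport E)
  (hEeq : ∀ x ∈ Icc (-(2 * b)) (2 * b), E x = Real.exp (x / 2) + Real.exp (-(x / 2)))
include hg hsupp

/-- **Out-of-window frequencies pair to zero.** If every out-class `(p, q)` of `Z` has
`2b < |log p − log q|`, then `∫ |ĝ(1/2+iy)|² Hsos(y) dy = 0`. [folklore] -/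
theorem integral_norm_sq_mul_Hsos_eq_zero (Z : SOSData)
    (hfreq : ∀ pq ∈ ratioClasses Z.Np, Z.isOut pq.1 pq.2 = true →
      2 * b < |Real.log pq.1 - Real.log pq.2|) :
    ∫ y : ℝ, ‖weilMellin g (1 / 2 + y * I)‖ ^ 2 * Z.Hsos y = 0 := by
  classical
  set ρ : ℝ → ℝ := fun y => ‖weilMellin g (1 / 2 + y * I)‖ ^ 2 with hρ
  have hG := tsupport_weilConv_weilReflect_subset (a := b) hg.2 hsupp
  -- each summand integrates to `2π Re (c/2)(G(x) + G(-x))`, which vanishes for out-classes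
  have hterm : ∀ pq ∈ ratioClasses Z.Np,
      (∫ y : ℝ, ρ y * (if Z.isOut pq.1 pq.2 = true then
        ((Z.classSum pq.1 pq.2 / 4 ^ Z.S : ℚ) : ℝ) * Real.cos (y * (Real.log pq.1 - Real.log pq.2)) else 0)) = 0 := by
    intro pq hpq
    by_cases hout : Z.isOut pq.1 pq.2 = true
    · simp only [hout, if_true]
      set c : ℝ := ((Z.classSum pq.1 pq.2 / 4 ^ Z.S : ℚ) : ℝ)
      set x : ℝ := Real.log pq.1 - Real.log pq.2
      have hx := hfreq pq hpq hout
      have hGx : weilConv g (weilReflect g) x = 0 := by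
        refine image_eq_zero_of_notMem_tsupport fun hm => ?_
        have := hG hm
        simp only [mem_Icc] at this
        have : |x| ≤ 2 * b := abs_le.2 ⟨by linarith [this.1], this.2⟩
        linarith
      have hGnx : weilConv g (weilReflect g) (-x) = 0 := by
        refine image_eq_zero_of_notMem_tsupport fun hm => ?_
        have := hG hm
        simp only [mem_Icc] at this
        have : |x| ≤ 2 * b := abs_le.2 ⟨by linarith [this.2], by linarith [this.1]⟩
        linarith
      have hnode := re_node_eq_spectral hg c x
      rw [hGx, hGnx, add_zero, mul_zero, Complex.zero_re] at hnode
      have h2 : (∫ y : ℝ, ρ y * (c * Real.cos (y * x))) = 0 := by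
        have hπ : (1 / (2 * π) : ℝ) ≠ 0 := by positivity
        have := hnode.symm
        rwa [mul_eq_zero, or_iff_right hπ] at this
      exact h2
    · simp [hout]
  -- integrability of each summand
  have hint : ∀ pq ∈ ratioClasses Z.Np, Integrable fun y => ρ y * (if Z.isOut pq.1 pq.2 = true then
      ((Z.classSum pq.1 pq.2 / 4 ^ Z.S : ℚ) : ℝ) * Real.cos (y * (Real.log pq.1 - Real.log pq.2)) else 0) := by
    intro pq _
    by_cases hout : Z.isOut pq.1 pq.2 = true
    · simp only [hout, if_true]
      have h := (integrable_norm_sq_weilMellin_mul_two_cos hg (Real.log pq.1 - Real.log pq.2)).const_mul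
        (((Z.classSum pq.1 pq.2 / 4 ^ Z.S : ℚ) : ℝ) / 2)
      refine (integrable_congr (Eventually.of_forall fun y => ?_)).1 h
      simp only [hρ]
      ring
    · simp [hout]
  unfold SOSData.Hsos
  calc (∫ y : ℝ, ρ y * ∑ pq ∈ ratioClasses Z.Np, (if Z.isOut pq.1 pq.2 = true then
        ((Z.classSum pq.1 pq.2 / 4 ^ Z.S : ℚ) : ℝ) * Real.cos (y * (Real.log pq.1 - Real.log pq.2)) else 0))
      = ∫ y : ℝ, ∑ pq ∈ ratioClasses Z.Np, ρ y * (if Z.isOut pq.1 pq.2 = true then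
        ((Z.classSum pq.1 pq.2 / 4 ^ Z.S : ℚ) : ℝ) * Real.cos (y * (Real.log pq.1 - Real.log pq.2)) else 0) := by
        congr 1 with y; rw [Finset.mul_sum]
    _ = ∑ pq ∈ ratioClasses Z.Np, ∫ y : ℝ, ρ y * (if Z.isOut pq.1 pq.2 = true then
        ((Z.classSum pq.1 pq.2 / 4 ^ Z.S : ℚ) : ℝ) * Real.cos (y * (Real.log pq.1 - Real.log pq.2)) else 0) :=
        integral_finsetSum _ hint
    _ = 0 := Finset.sum_eq_zero hterm

include hEc hEs hEeq

/-- **Positivity transfer with an out-of-window correction.** If `F + Hsos ≥ 0` pointwise, where `F`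
is the density of the certificate and every out-class of `Z` has `2b < |log p − log q|`, then
`-s‖g‖₂² ≤ Re (W_ar(G) − Σ_n (a_n/2)(G(log n) + G(−log n)))` for every Weil test `g` supported in
`[-b, b]`. [folklore] -/
theorem neg_slack_le_of_density_add_Hsos_nonneg (s : ℝ) (nodes : Finset ℕ) (a : ℕ → ℝ) (Z : SOSData)
    (hfreq : ∀ pq ∈ ratioClasses Z.Np, Z.isOut pq.1 pq.2 = true →
      2 * b < |Real.log pq.1 - Real.log pq.2|)
    (hF : ∀ y : ℝ, 0 ≤ Literature.Analysis.SpecialFunctions.reDigammaQuarter y - Real.log π + s +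
      cosTransform E y - ∑ n ∈ nodes, a n * Real.cos (y * Real.log n) + Z.Hsos y) :
    -(s * weilNorm2Sq g) ≤
      (weilPolarTerm (weilConv g (weilReflect g)) + weilArchTerm (weilConv g (weilReflect g)) -
        ∑ n ∈ nodes, ((a n / 2 : ℝ) : ℂ) *
          (weilConv g (weilReflect g) (Real.log n) + weilConv g (weilReflect g) (-Real.log n))).re := by
  have hid := slackFunctional_eq_spectralIntegral hg hsupp hEc hEs hEeq s nodes a
  set ρ : ℝ → ℝ := fun y => ‖weilMellin g (1 / 2 + y * I)‖ ^ 2 with hρ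
  set F : ℝ → ℝ := fun y => Literature.Analysis.SpecialFunctions.reDigammaQuarter y - Real.log π + s +
      cosTransform E y - ∑ n ∈ nodes, a n * Real.cos (y * Real.log n) with hFdef
  -- integrability of ρ F (as in the identity file)
  have iR : Integrable fun y => ρ y * Literature.Analysis.SpecialFunctions.reDigammaQuarter y :=
    integrable_norm_sq_weilMellin_mul_reDigammaQuarter hg
  have i1 : Integrable ρ := integrable_norm_sq_weilMellin_half_line hg
  have iE : Integrable fun y => ρ y * cosTransform E y :=
    integrable_norm_sq_weilMellin_mul hg (continuous_cosTransform hEc hEs).measurable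
      (A := ∫ x : ℝ, |E x|) (B := 0) (integral_nonneg fun x => abs_nonneg _) le_rfl
      fun t => by rw [zero_mul, add_zero]; exact abs_cosTransform_le hEc hEs t
  have iC : ∀ n ∈ nodes, Integrable fun y => ρ y * (a n * Real.cos (y * Real.log n)) := by
    intro n _
    have h := (integrable_norm_sq_weilMellin_mul_two_cos hg (Real.log n)).const_mul (a n / 2)
    refine (integrable_congr (Eventually.of_forall fun y => ?_)).1 h
    simp only [hρ]
    ring
  have iS : Integrable fun y => ρ y * ∑ n ∈ nodes, a n * Real.cos (y * Real.log n) := by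
    have : (fun y => ρ y * ∑ n ∈ nodes, a n * Real.cos (y * Real.log n)) =
        fun y => ∑ n ∈ nodes, ρ y * (a n * Real.cos (y * Real.log n)) := by
      funext y; rw [Finset.mul_sum]
    rw [this]
    exact integrable_finsetSum _ iC
  have iF : Integrable fun y => ρ y * F y := by
    have e : (fun y => ρ y * F y) = fun y => ρ y * Literature.Analysis.SpecialFunctions.reDigammaQuarter y -
        Real.log π * ρ y + s * ρ y + ρ y * cosTransform E y -
          ρ y * ∑ n ∈ nodes, a n * Real.cos (y * Real.log n) := by
      funext y; simp only [hFdef]; ring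
    rw [e]
    exact (((iR.sub (i1.const_mul _)).add (i1.const_mul _)).add iE).sub iS
  -- integrability of ρ H
  have iH : Integrable fun y => ρ y * Z.Hsos y := by
    classical
    have e : (fun y => ρ y * Z.Hsos y) = fun y => ∑ pq ∈ ratioClasses Z.Np, ρ y *
        (if Z.isOut pq.1 pq.2 = true then ((Z.classSum pq.1 pq.2 / 4 ^ Z.S : ℚ) : ℝ) *
          Real.cos (y * (Real.log pq.1 - Real.log pq.2)) else 0) := by
      funext y; unfold SOSData.Hsos; rw [Finset.mul_sum]
    rw [e]
    refine integrable_finsetSum _ fun pq _ => ?_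
    by_cases hout : Z.isOut pq.1 pq.2 = true
    · simp only [hout, if_true]
      have h := (integrable_norm_sq_weilMellin_mul_two_cos hg (Real.log pq.1 - Real.log pq.2)).const_mul
        (((Z.classSum pq.1 pq.2 / 4 ^ Z.S : ℚ) : ℝ) / 2)
      refine (integrable_congr (Eventually.of_forall fun y => ?_)).1 h
      simp only [hρ]
      ring
    · simp [hout]
  -- ∫ ρ F = ∫ ρ (F + H) ≥ 0
  have hH0 := integral_norm_sq_mul_Hsos_eq_zero hg hsupp Z hfreq
  have hpos : 0 ≤ ∫ y : ℝ, ρ y * F y := by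
    have e : (∫ y : ℝ, ρ y * F y) = ∫ y : ℝ, (ρ y * (F y + Z.Hsos y) - ρ y * Z.Hsos y) := by
      congr 1 with y; ring
    rw [e, integral_sub (by
      have : (fun y => ρ y * (F y + Z.Hsos y)) = fun y => ρ y * F y + ρ y * Z.Hsos y := by funext y; ring
      rw [this]; exact iF.add iH) iH, hH0, sub_zero]
    exact integral_nonneg fun y => mul_nonneg (sq_nonneg _) (by have := hF y; simp only [hFdef]; linarith)
  have hrhs : 0 ≤ 1 / (2 * π) * ∫ y : ℝ, ρ y * F y := mul_nonneg (by positivity) hpos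
  simp only [hρ, hFdef] at hrhs
  linarith [hid, hrhs]

end SpectralH

end Summit.RiemannHypothesis.RiemannHypothesis.Theorems.SignCone

end
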